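import Summits.QuantumFields.YangMills.Theorems.LuscherReductionTwistedTraceScalingBTPointwiseTail
import HarnessLib

/-!
# The DRESSED colour average: `|fpBOKernel(w,u') − C·D(w)D(u')K₁(w,u')| ≤ κCD(w)D(u')K₁(w,u') + τ` on the window ⇒ `|𝒦(u,u') − (C/Z)D(u)D(u')K̃₁(u,u')| ≤ κ(C/Z)D(u)D(u')K̃₁(u,u') + τ/Z`
# for a conjugation-invariant dressing `D ≥ 0` (route `FlatTubeReduction`, crux K1 `NearFlatRatioLaw` stmt-QuantumFields-24720; seat `ym-line-ftr-p1` g15; rate twin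
# «ratepack-v3 / frozen fibres»; R2b1 RECORD rung — no summit statement is proved here)

WHY (memo `Cruxes/NearFlatRatioLaw/Lines/ratepack-v3-frozen-g12.md` §8.3; PICKED.md g15).  Lane A's `…BTPointwiseTail.boKernel_pointwise_of_fp_add` carries the UNdressed comparison
`fpBOKernel ≈ C·K₁` through the global-colour Faddeev–Popov identity `Z·𝒦(u,u') = ∫_c fpBOKernel(c⁻¹uc, u') dc` (`…BTColourFP.boKernel_fp`).  The rate twin compares with the DRESSED
one-site kernel `C·D(u)D(u')·K₁(u,u')`, `D = √f` the exact diagonal dressing (`…SymmetricCorePair`), which is conjugation invariant (`diagRatio_gaugeTransform`); since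
`D(c⁻¹uc)D(u') = D(u)D(u')` is constant along the colour orbit, the same identity integrates the dressed comparison: ★★★ `boKernel_dressed_pointwise_of_fp_add` — exactly the `hpt`
hypothesis of `…TubeFormNearFarNormalised.tubeForm_boFunAd_normalised_near_of_nearFar` with `c = C/Z`, `V = D`, `θ = τ/Z`.
HONEST FRAMING: measure bookkeeping for a stub of the CONDITIONAL reduction route R2b1; femto rung R2b1 (RECORD label); not infinite volume, not a gap, not Clay.  No defs, no named facts,
no `sorry`.
-/

set_option autoImplicit false

noncomputable section

open MeasureTheory Filter Topology Real
open scoped BigOperators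
open Literature.MathematicalPhysics.QuantumFieldTheory
open Literature.MathematicalPhysics.QuantumLattice

namespace Summit.QuantumFields.YangMills.Theorems.FemtoTransferGap.TwoLattice.ConstTube

open Summit.QuantumFields.YangMills.Theorems.FemtoTransferGap
open Summit.QuantumFields.YangMills.Theorems.FemtoTransferGap.TwoLattice.Avg
open Summit.QuantumFields.YangMills.Theorems.FemtoTransferGap.TwoLattice.Stiff (LinkSpace)

variable {L : ℕ} [NeZero L]

/-- ★★★ **DRESSED COLOUR AVERAGE.**  Colour-blind bounded measurable `Ω`, an FP weight `W` (bounded measurable, colour-orbit integral `Z > 0`), a conjugation-invariant dressing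
`D` on the one-site configurations, and on the (conjugation-invariant) window `{orbitDist < δ}`:
`|fpBOKernel(w,u') − C·D(w)D(u')·K₁^{(B)}(w,u')| ≤ κ·C·D(w)D(u')·K₁^{(B)}(w,u') + τ`.  Then on the window
`|𝒦_β(u,u') − (C/Z)·D(u)D(u')·K̃₁^{(B)}(u,u')| ≤ κ·(C/Z)·D(u)D(u')·K̃₁^{(B)}(u,u') + τ/Z`. [cite: Luscher1983, §3] -/
theorem boKernel_dressed_pointwise_of_fp_add (β B : ℝ) {Ω : LinkSpace L → ℝ} (hΩm : Measurable Ω) {CΩ : ℝ} (hCΩ : ∀ x, |Ω x| ≤ CΩ)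
    (hΩinv : ∀ (g : SU2) (x : LinkSpace L), Ω (adL L g x) = Ω x)
    {W : (Site 3 L → SU2) → ℝ} (hW : Measurable W) {CW : ℝ} (hCW : ∀ g, |W g| ≤ CW) {Z : ℝ} (hZ0 : 0 < Z)
    (hZ : ∀ g : Site 3 L → SU2, ∫ c, W (fun x => c * g x) ∂haarProbability SU2 = Z)
    {D : GaugeConfig 3 1 SU2 → ℝ} (hDinv : ∀ (c : SU2) (u : GaugeConfig 3 1 SU2), D (gaugeTransform (fun _ : Site 3 1 => c) u) = D u)
    {C κ τ δ : ℝ}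
    (hpt : ∀ w u' : GaugeConfig 3 1 SU2, orbitDist w < δ → orbitDist u' < δ →
      |fpBOKernel L β Ω W w u' - C * (D w * D u') * transferKernel su2Rep B w u'| ≤ κ * C * (D w * D u') * transferKernel su2Rep B w u' + τ)
    (u u' : GaugeConfig 3 1 SU2) (hu : orbitDist u < δ) (hu' : orbitDist u' < δ) :
    |boKernel L β Ω u u' - C / Z * (D u * D u') * avgKernel B u u'| ≤ κ * (C / Z) * (D u * D u') * avgKernel B u u' + τ / Z := by
  haveI : SecondCountableTopology SU2 := secondCountableTopology_su2
  obtain ⟨hint, hid⟩ := boKernel_fp (L := L) β hΩm hCΩ hΩinv hW hCW hZ u u'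
  have hK1m : Measurable fun c : SU2 => transferKernel su2Rep B (gaugeTransform (fun _ : Site 3 1 => c⁻¹) u) u' := by
    have h1 : Measurable fun c : SU2 => gaugeTransform (fun _ : Site 3 1 => c⁻¹) u := by
      have h := (measurable_constGaugeAction_left (L := 1) u).comp measurable_inv
      simpa only [Function.comp_def] using h
    have h2 : Measurable fun c : SU2 => (gaugeTransform (fun _ : Site 3 1 => c⁻¹) u, u') := h1.prodMk measurable_const
    have h := (continuous_transferKernel su2Rep continuous_su2Rep B (L := 1)).measurable.comp h2
    simpa only [Function.comp_def] using h
  obtain ⟨M1, hM1⟩ := exists_transferKernel_le su2Rep continuous_su2Rep B (L := 1)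
  have hK1int : Integrable (fun c : SU2 => transferKernel su2Rep B (gaugeTransform (fun _ : Site 3 1 => c⁻¹) u) u') (haarProbability SU2) :=
    integrable_of_measurable_abs_le _ hK1m (C := M1) fun c => by rw [abs_of_pos (transferKernel_pos su2Rep B _ _)]; exact hM1 _ _
  have hav := avgKernel_one_eq_integral_conj B u u'
  -- along the colour orbit the dressing is constant
  have hptc : ∀ c : SU2, |fpBOKernel L β Ω W (gaugeTransform (fun _ : Site 3 1 => c⁻¹) u) u' -
      C * (D u * D u') * transferKernel su2Rep B (gaugeTransform (fun _ : Site 3 1 => c⁻¹) u) u'| ≤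
      κ * C * (D u * D u') * transferKernel su2Rep B (gaugeTransform (fun _ : Site 3 1 => c⁻¹) u) u' + τ := fun c => by
    have h := hpt (gaugeTransform (fun _ : Site 3 1 => c⁻¹) u) u' (by rw [orbitDist_gaugeTransform]; exact hu) hu'
    rw [hDinv] at h; exact h
  have hdiff : boKernel L β Ω u u' - C / Z * (D u * D u') * avgKernel B u u' =
      Z⁻¹ * ∫ c, (fpBOKernel L β Ω W (gaugeTransform (fun _ : Site 3 1 => c⁻¹) u) u' -
        C * (D u * D u') * transferKernel su2Rep B (gaugeTransform (fun _ : Site 3 1 => c⁻¹) u) u') ∂haarProbability SU2 := by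
    rw [integral_sub hint (hK1int.const_mul (C * (D u * D u'))), integral_const_mul, ← hid, ← hav]
    field_simp
  have hI : |∫ c, (fpBOKernel L β Ω W (gaugeTransform (fun _ : Site 3 1 => c⁻¹) u) u' -
      C * (D u * D u') * transferKernel su2Rep B (gaugeTransform (fun _ : Site 3 1 => c⁻¹) u) u') ∂haarProbability SU2| ≤ κ * C * (D u * D u') * avgKernel B u u' + τ := by
    rw [hav]
    calc |∫ c, (fpBOKernel L β Ω W (gaugeTransform (fun _ : Site 3 1 => c⁻¹) u) u' -
          C * (D u * D u') * transferKernel su2Rep B (gaugeTransform (fun _ : Site 3 1 => c⁻¹) u) u') ∂haarProbability SU2|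
        ≤ ∫ c, |fpBOKernel L β Ω W (gaugeTransform (fun _ : Site 3 1 => c⁻¹) u) u' -
          C * (D u * D u') * transferKernel su2Rep B (gaugeTransform (fun _ : Site 3 1 => c⁻¹) u) u'| ∂haarProbability SU2 := abs_integral_le_integral_abs
      _ ≤ ∫ c, (κ * C * (D u * D u') * transferKernel su2Rep B (gaugeTransform (fun _ : Site 3 1 => c⁻¹) u) u' + τ) ∂haarProbability SU2 :=
          integral_mono_of_nonneg (ae_of_all _ fun _ => abs_nonneg _) ((hK1int.const_mul _).add (integrable_const _)) (ae_of_all _ hptc)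
      _ = κ * C * (D u * D u') * ∫ c, transferKernel su2Rep B (gaugeTransform (fun _ : Site 3 1 => c⁻¹) u) u' ∂haarProbability SU2 + τ := by
          rw [integral_add (hK1int.const_mul _) (integrable_const _), integral_const_mul]; simp
  rw [hdiff, abs_mul, abs_of_pos (inv_pos.mpr hZ0)]
  calc Z⁻¹ * |∫ c, (fpBOKernel L β Ω W (gaugeTransform (fun _ : Site 3 1 => c⁻¹) u) u' -
        C * (D u * D u') * transferKernel su2Rep B (gaugeTransform (fun _ : Site 3 1 => c⁻¹) u) u') ∂haarProbability SU2|
      ≤ Z⁻¹ * (κ * C * (D u * D u') * avgKernel B u u' + τ) := mul_le_mul_of_nonneg_left hI (inv_pos.mpr hZ0).le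
    _ = κ * (C / Z) * (D u * D u') * avgKernel B u u' + τ / Z := by field_simp

end Summit.QuantumFields.YangMills.Theorems.FemtoTransferGap.TwoLattice.ConstTube

end
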